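import Summits.BirchSwinnertonDyer.BirchSwinnertonDyer.Theorems.PrintCf2SplitBadTwoTorsionStrictMasterIdentity
import Summits.BirchSwinnertonDyer.BirchSwinnertonDyer.Theorems.PrintCf2SplitBadTwoCMPrimaryDyadicTableRelaxed
import Summits.BirchSwinnertonDyer.BirchSwinnertonDyer.Theorems.SchneiderFreeAdditiveX3AnticycControlAdditiveLevelLimitAnyTorsion
import HarnessLib

/-!
# Crux `PrintCf2.SplitBadTwoRankOneOfFacts` (stmt-BirchSwinnertonDyer-20368), road α v10.3, S3c input (F3):
# the two LOCAL FACTORS `#(N^E_v ⊓ A) = #W*(K_v) = 2` and `#(𝓞_v ⧸ 2^N) = 2^N` of the Option-A‴ master identity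

Cell `bsd-print-cf2`, EXTRA WIDTH seat `bsd-line-cf2-p1-w4` g10 (prover-bsd-line-cf2-p1-w4-g10-0); `--supports stmt-BirchSwinnertonDyer-20368`
(helper, Theses-free). HONEST FRAMING: nothing here closes the crux or a registered stub; BSD is not proved by any of this; no summit
statement is proved by this seat. No definition, no named fact, no `sorry`.

WHAT (pieces (LF.2), (LF.3) of -w2 g11's decomposition, STATUS 2026-08-28T23:38:20Z, of the displayed hypothesis `hcounts` of -w5 g3 p678471
`hF3_of_levelCounts` through -w4 g9's master identity p678152 `relIndex_selmerGroup_update_top_mul_eq_of_levelProj`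
«`[𝓕[⊤ at v] : 𝓕] · #loc_v(H¹_{𝓕*}) · #(N^E_v ⊓ A) = #E(K_v)[2^N] · #(𝓞_v ⧸ 2^N)`», `A = range H¹(ẽ_N|K_v)`):
* §1 (LF.2, generic) `natCard_ker_inf_range_map_levelProj_eq`: for ANY elliptic `V/K`, prime `p`, level `k`, equivariant projector
  `e : E[p^∞] → W* = E[𝔮_r^∞]` (identity on `W*`) with level shadow `ẽ_k` (`ι ∘ ẽ_k = e ∘ ι`) and finite place `v`,
  **`#(N^E_v ⊓ range H¹(ẽ_k|K_v)) = #W*^{D_v}`** as soon as `p^k · W*^{D_v} = 0`: the torsion classes `N^E_v = ker(H¹(K_v, E[p^k]) → H¹(K_v, E[p^∞]))`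
  are the connecting classes `δ(Q)` (`p^k Q` fixed, X11b `map_primaryInclusion_restrictField_eq_zero_iff`), `H¹(ẽ_k) δ(Q) = δ(e Q)`
  (`map_levelProj_connectingClass`), and `m ↦ δ(e Q_m)` (`p^k Q_m = m`) is a bijection `W*^{D_v} ≃ N^E_v ⊓ range H¹(ẽ_k)`
  (door-c6's `SchneiderFreeAdditiveX3.natCard_ker_map_primaryInclusion_eq` transplanted to `K_v` and twisted by `e`).
* §2 (LF.3) `natCard_quot_adicCompletionIntegers_two_pow_of_split`: `#(𝓞_v ⧸ 2^N) = 2^N` at a place `v ≠ v̄` above `2` of a quadratic field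
  (degree one: `𝓞_v ≅ ℤ₂`).
* §3 (LF.2 on the frame) `natCard_ker_inf_range_map_levelProj_eq_two_of_frame`: `= 2` on every S3c frame for `N ≥ 1` (-w2 g9
  `CMPrimes.natCard_fixedPoints_decomp_v_eq_two_of_frame`: `#W*^{D_v} = 2`, killed by `2 ∣ 2^N`).
Consumer: this seat's `PrintCf2SplitBadTwoLevelCountsOfLocalFactors` ((ASM) `hcounts ⟸ (LF.1) ∧ (T4)`).
presearch: Greenberg LNM 1716 §5 (proof of Prop. 5.8: `ker(H¹(E[p^k]) → H¹(E[p^∞]))` = image of the torsion), Rubin LNM 1716 §2 (CM splitting),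
Neukirch II (8.2) → tree theorems (X11b `TorsionLevelCohomology`/`PrimaryInclusionLevels`, door-c6 `natCard_ker_map_primaryInclusion_eq`,
`placesOver_trichotomy_of_finrank_eq_two`); no new fact. beyond-print theorem: no.

References: [GreenbergLNM1716] §2 p. 63, §5 proof of Prop. 5.8; [Rubin1999] §2, §3 Lemma 3.6, Prop. 5.4; [Agboola2007] §6, Prop. 8.1;
[MilneADT2006] I Lemma 3.3; [SilvermanAEC2009] VIII.§2; [NeukirchANT1999] II §8 (8.2), (8.5).
-/

noncomputable section

open scoped Classical

set_option linter.dupNamespace false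
set_option autoImplicit false

open Function Field NumberField IsDedekindDomain WeierstrassCurve
open Literature.NumberTheory.EllipticCurves Literature.NumberTheory.EllipticCurves.GreenbergSelmer
open Literature.NumberTheory.EllipticCurves.Agboola2007
open Literature.NumberTheory.GaloisRepresentations
open Literature.NumberTheory.GaloisRepresentations.DiscreteGaloisModule (localTatePairingZMod tateDual SelmerStructure mu)
open Literature.NumberTheory.GaloisCohomology
open Literature.NumberTheory.GaloisCohomology.LocalInvariants
open scoped ContRepresentation
open Summit.BirchSwinnertonDyer.Rank1Residual.X11b
open Summit.BirchSwinnertonDyer.Rank1Residual.X11b.Levels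
open Summit.BirchSwinnertonDyer.BirchSwinnertonDyer.Theorems.SchneiderFreeAdditiveX3 (connectingClass_sub connectingClass_eq_of_nsmul_eq)

namespace Summit.BirchSwinnertonDyer.BirchSwinnertonDyer.Theorems.PrintCf2.RestrictedSelmerPair

/-! ## §1. (LF.2), generic: `#(N^E_v ⊓ range H¹(ẽ_k|K_v)) = #W*^{D_v}` when `p^k · W*^{D_v} = 0` -/

section LocalFactor

variable {K : Type} [Field K] [NumberField K] (V : WeierstrassCurve K) [V.IsElliptic] (p k : ℕ) [hp : Fact p.Prime]
  (π : V.endRing) (r : ℤ_[p])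
  (e : V.geomPrimaryTorsion p →+ ↥(V.endEigenPrimaryTorsion p π r))
  (he₁ : ∀ x : ↥(V.endEigenPrimaryTorsion p π r), e x = x)
  (he : ∀ (σ : absoluteGaloisGroup K) (x : V.geomPrimaryTorsion p), e (σ • x) = σ • e x)
  (eN : (V.torsionGaloisModule ((p ^ k : ℕ) : ℤ)).toContRepresentation →ⁱL (V.torsionGaloisModule ((p ^ k : ℕ) : ℤ)).toContRepresentation)
  (heN : ∀ y, primaryInclusion V p k (eN y) = (e (primaryInclusion V p k y) : V.geomPrimaryTorsion p))
  (E : Type) [Field E] [Algebra K E]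

omit [NumberField K] [V.IsElliptic] in
include he₁ heN in
/-- The level shadow of a projector is idempotent: `ι (ẽ (ẽ y)) = e (e (ι y)) = e (ι y) = ι (ẽ y)` and `ι` is injective. [cite: Rubin1999, §2] -/
theorem levelProj_idem_of_primaryInclusion_eq (y : V.geomTorsion ((p ^ k : ℕ) : ℤ)) : eN (eN y) = eN y := by
  apply primaryInclusion_injective V p k
  rw [heN, heN, he₁]

omit [NumberField K] [V.IsElliptic] in
include he heN in
/-- **`H¹(ẽ_k) δ(Q) = δ(e Q)` over any `K`-field `E`** (a completion): the push-forward along the level shadow `ẽ_k` of the connecting class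
of `Q ∈ E[p^∞]` (`p^k Q` fixed by `Γ_E`) for `ι_k : E[p^k] ↪ E[p^∞]` is the connecting class of `e Q` — on cocycles,
`ι (ẽ (ι⁻¹(σQ − Q))) = e(σQ − Q) = σ(eQ) − eQ`. [cite: GreenbergLNM1716, §5 proof of Prop. 5.8] [cite: Rubin1999, §2] -/
theorem map_levelProj_connectingClass (Q : V.geomPrimaryTorsion p)
    (hQ : ∀ σ : absoluteGaloisGroup E, GaloisRep.restrictField E (LocBridge.primaryGaloisModule V p) σ (p ^ k • Q) = p ^ k • Q)
    (heQ : ∀ σ : absoluteGaloisGroup E, GaloisRep.restrictField E (LocBridge.primaryGaloisModule V p) σ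
      (p ^ k • (e Q : V.geomPrimaryTorsion p)) = p ^ k • (e Q : V.geomPrimaryTorsion p)) :
    galoisCohomology.map (eN.restrictField E) 1
        (connectingClass ((primaryInclusion V p k).restrictField E) (p ^ k)
          (exists_primaryInclusion_restrictField_eq_of_nsmul_eq_zero V p k E) (primaryInclusion_restrictField_injective V p k E) Q hQ) =
      connectingClass ((primaryInclusion V p k).restrictField E) (p ^ k)
        (exists_primaryInclusion_restrictField_eq_of_nsmul_eq_zero V p k E) (primaryInclusion_restrictField_injective V p k E)
        (e Q : V.geomPrimaryTorsion p) heQ := by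
  rw [connectingClass, connectingClass, galoisCohomology.map_one_oneCocycleClass]
  refine congrArg (oneCocycleClass _) (Subtype.ext (ContinuousMap.ext fun σ ↦ ?_))
  apply primaryInclusion_restrictField_injective V p k E
  change (primaryInclusion V p k).restrictField E (eN ((liftCocycle ((primaryInclusion V p k).restrictField E) (p ^ k)
      (exists_primaryInclusion_restrictField_eq_of_nsmul_eq_zero V p k E) (primaryInclusion_restrictField_injective V p k E)
      (Levels.cobCocycle (GaloisRep.restrictField E (LocBridge.primaryGaloisModule V p)) Q) (nsmul_cobCocycle_apply_eq_zero (p ^ k) hQ)).1 σ)) =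
    (primaryInclusion V p k).restrictField E ((liftCocycle ((primaryInclusion V p k).restrictField E) (p ^ k)
      (exists_primaryInclusion_restrictField_eq_of_nsmul_eq_zero V p k E) (primaryInclusion_restrictField_injective V p k E)
      (Levels.cobCocycle (GaloisRep.restrictField E (LocBridge.primaryGaloisModule V p)) (e Q : V.geomPrimaryTorsion p))
      (nsmul_cobCocycle_apply_eq_zero (p ^ k) heQ)).1 σ)
  have h1 : ∀ z, (primaryInclusion V p k).restrictField E (eN z) = (e (((primaryInclusion V p k).restrictField E) z) : V.geomPrimaryTorsion p) :=
    fun z ↦ heN z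
  rw [h1, apply_liftCocycle (primaryInclusion_restrictField_injective V p k E),
    apply_liftCocycle (primaryInclusion_restrictField_injective V p k E), Levels.cobCocycle_apply, Levels.cobCocycle_apply, map_sub]
  change ((e (absGaloisRestrict K E σ • Q) : V.geomPrimaryTorsion p)) - (e Q : V.geomPrimaryTorsion p) =
    absGaloisRestrict K E σ • (e Q : V.geomPrimaryTorsion p) - (e Q : V.geomPrimaryTorsion p)
  rw [he, endEigenPrimaryTorsion.coe_smul]

include he₁ he heN in
/-- **(LF.2), generic: `#(N^E_v ⊓ range H¹(ẽ_k|K_v)) = #W*^{D_v}` when `p^k · W*^{D_v} = 0`.** Here `N^E_v = ker(H¹(K_v, E[p^k]) → H¹(K_v, E[p^∞]))`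
(the torsion classes), `ẽ_k` the level shadow of the equivariant projector `e` onto `W* = E[𝔮_r^∞]` (identity on `W*`), `D_v` the decomposition
group: `m ↦ δ(e Q_m)` (`p^k Q_m = m`, divisibility of `E(K̄)`) is a bijection `W*^{D_v} ≃ N^E_v ⊓ range H¹(ẽ_k)` — injective by
`δ(b) − δ(b') = δ(b − b')` and `δ(b) = 0 ↔ p^k b ∈ p^k · E[p^∞]^{Γ_{K_v}}` projected by `e`, surjective since a class of `N^E_v` fixed by the
idempotent `H¹(ẽ_k)` is `δ(e Q)`. (door-c6 `natCard_ker_map_primaryInclusion_eq` over `K_v`, twisted by `e`.)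
[cite: GreenbergLNM1716, §2 p. 63 and §5 proof of Prop. 5.8] [cite: Rubin1999, §2] [cite: SilvermanAEC2009, VIII.§2] -/
theorem natCard_ker_inf_range_map_levelProj_eq (v : HeightOneSpectrum (𝓞 K))
    (hk : ∀ m : ↥(V.endEigenPrimaryTorsion p π r), (∀ d ∈ decomp v, d • m = m) → p ^ k • m = 0) :
    Nat.card (((galoisCohomology.map ((primaryInclusion V p k).restrictField (v.adicCompletion K)) 1).ker ⊓
        (galoisCohomology.map (eN.restrictField (v.adicCompletion K)) 1).range : AddSubgroup _)) =
      Nat.card (FixedPoints.addSubgroup (decomp v) ↥(V.endEigenPrimaryTorsion p π r)) := by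
  have hdiv : V.zsmul_geomPoints_surjective := V.zsmul_geomPoints_surjective_holds
  set L := v.adicCompletion K with hL
  have hroot0 := exists_primaryInclusion_restrictField_eq_of_nsmul_eq_zero V p k L
  have hinj := primaryInclusion_restrictField_injective V p k L
  set f := galoisCohomology.map (eN.restrictField L) 1 with hf
  set Fx := FixedPoints.addSubgroup (decomp v) ↥(V.endEigenPrimaryTorsion p π r) with hFx
  -- the action of `Γ_{K_v}` through `D_v`
  have hact : ∀ (σ : absoluteGaloisGroup L) (Q : V.geomPrimaryTorsion p),
      GaloisRep.restrictField L (LocBridge.primaryGaloisModule V p) σ Q = absGaloisRestrict K L σ • Q := fun _ _ ↦ rfl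
  have hmem : ∀ σ : absoluteGaloisGroup L, absGaloisRestrict K L σ ∈ decomp v := fun σ ↦ (mem_decomp_iff v _).mpr ⟨σ, rfl⟩
  -- `e` is idempotent, `ẽ` is idempotent, `e` commutes with `p^k`
  have hidem : ∀ y, eN (eN y) = eN y := levelProj_idem_of_primaryInclusion_eq V p k π r e he₁ eN heN
  have hee : ∀ Q : V.geomPrimaryTorsion p, e (e Q : V.geomPrimaryTorsion p) = e Q := fun Q ↦ he₁ (e Q)
  -- fixed points of `W*` under `D_v`, read in `E[p^∞]`
  have hFfix : ∀ m : Fx, ∀ σ : absoluteGaloisGroup L,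
      absGaloisRestrict K L σ • ((m : ↥(V.endEigenPrimaryTorsion p π r)) : V.geomPrimaryTorsion p) =
        ((m : ↥(V.endEigenPrimaryTorsion p π r)) : V.geomPrimaryTorsion p) := fun m σ ↦ by
    have h := (FixedPoints.mem_addSubgroup (decomp v) _ _).mp m.2 ⟨_, hmem σ⟩
    exact congrArg Subtype.val h
  -- a `p^k`-th root `Q_m ∈ E[p^∞]` of each fixed point, and `e Q_m ∈ W*` is again one
  have hroot : ∀ m : Fx, ∃ b : V.geomPrimaryTorsion p,
      p ^ k • b = ((m : ↥(V.endEigenPrimaryTorsion p π r)) : V.geomPrimaryTorsion p) := fun m ↦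
    exists_pow_nsmul_eq_geomPrimaryTorsion V p k hdiv _
  choose root hroot using hroot
  have heroot : ∀ m : Fx, p ^ k • (e (root m) : V.geomPrimaryTorsion p) =
      ((m : ↥(V.endEigenPrimaryTorsion p π r)) : V.geomPrimaryTorsion p) := fun m ↦ by
    rw [← AddSubgroupClass.coe_nsmul, ← map_nsmul, hroot m, he₁]
  have hfix : ∀ m : Fx, ∀ σ : absoluteGaloisGroup L,
      GaloisRep.restrictField L (LocBridge.primaryGaloisModule V p) σ (p ^ k • (e (root m) : V.geomPrimaryTorsion p)) =
        p ^ k • (e (root m) : V.geomPrimaryTorsion p) := fun m σ ↦ by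
    rw [hact, heroot m]; exact hFfix m σ
  -- the candidate bijection `m ↦ δ(e Q_m)`
  have hmemS : ∀ m : Fx, connectingClass ((primaryInclusion V p k).restrictField L) (p ^ k) hroot0 hinj (e (root m) : V.geomPrimaryTorsion p) (hfix m) ∈
      ((galoisCohomology.map ((primaryInclusion V p k).restrictField L) 1).ker ⊓ f.range : AddSubgroup _) := fun m ↦ by
    refine AddSubgroup.mem_inf.mpr ⟨?_, ?_⟩
    · exact (AddMonoidHom.mem_ker).mpr ((map_primaryInclusion_restrictField_eq_zero_iff V p k L _).mpr ⟨_, hfix m, rfl⟩)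
    · refine ⟨connectingClass ((primaryInclusion V p k).restrictField L) (p ^ k) hroot0 hinj (e (root m) : V.geomPrimaryTorsion p) (hfix m), ?_⟩
      have hfix' : ∀ σ : absoluteGaloisGroup L, GaloisRep.restrictField L (LocBridge.primaryGaloisModule V p) σ
          (p ^ k • (e (e (root m) : V.geomPrimaryTorsion p) : V.geomPrimaryTorsion p)) =
            p ^ k • (e (e (root m) : V.geomPrimaryTorsion p) : V.geomPrimaryTorsion p) := by
        rw [hee]; exact hfix m
      rw [hf, map_levelProj_connectingClass V p k π r e he eN heN L _ (hfix m) hfix']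
      exact connectingClass_eq_of_nsmul_eq hinj _ _ hfix' (hfix m) (by rw [hee])
  let ψ : Fx → ((galoisCohomology.map ((primaryInclusion V p k).restrictField L) 1).ker ⊓ f.range : AddSubgroup _) := fun m ↦ ⟨_, hmemS m⟩
  refine (Nat.card_congr (Equiv.ofBijective ψ ⟨?_, ?_⟩)).symm
  · -- injective
    intro m m' hmm'
    have h1 := congrArg Subtype.val hmm'
    change connectingClass ((primaryInclusion V p k).restrictField L) (p ^ k) hroot0 hinj (e (root m) : V.geomPrimaryTorsion p) (hfix m) =
      connectingClass ((primaryInclusion V p k).restrictField L) (p ^ k) hroot0 hinj (e (root m') : V.geomPrimaryTorsion p) (hfix m') at h1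
    rw [← sub_eq_zero, connectingClass_sub hinj, connectingClass_eq_zero_iff hinj (pow_nsmul_geomTorsion_eq_zero V p k)] at h1
    obtain ⟨b₀, hb₀, hb₀k⟩ := h1
    -- `e b₀ ∈ W*` is `D_v`-fixed, hence killed by `p^k`
    have heb₀ : p ^ k • e b₀ = 0 := by
      refine hk (e b₀) fun d hd ↦ ?_
      obtain ⟨σ, rfl⟩ := (mem_decomp_iff v d).mp hd
      rw [← he, ← hact, hb₀ σ]
    have h2 : e (p ^ k • b₀) = e (p ^ k • ((e (root m) : V.geomPrimaryTorsion p) - (e (root m') : V.geomPrimaryTorsion p))) := by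
      rw [hb₀k]
    rw [map_nsmul, heb₀, smul_sub, heroot m, heroot m', ← AddSubgroup.coe_sub, he₁, eq_comm, sub_eq_zero] at h2
    exact Subtype.ext h2
  · -- surjective
    rintro ⟨c, hc⟩
    obtain ⟨hcker, hcrange⟩ := AddSubgroup.mem_inf.mp hc
    obtain ⟨Q, hQ, hcQ⟩ := (map_primaryInclusion_restrictField_eq_zero_iff V p k L c).mp ((AddMonoidHom.mem_ker).mp hcker)
    -- `c = f c = δ(e Q)`
    have hfc : f c = c := by
      obtain ⟨y, rfl⟩ := hcrange
      exact map_levelProj_idem V p k L eN hidem y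
    have heQfix : ∀ σ : absoluteGaloisGroup L, GaloisRep.restrictField L (LocBridge.primaryGaloisModule V p) σ
        (p ^ k • (e Q : V.geomPrimaryTorsion p)) = p ^ k • (e Q : V.geomPrimaryTorsion p) := fun σ ↦ by
      rw [hact, ← AddSubgroupClass.coe_nsmul, ← map_nsmul, ← endEigenPrimaryTorsion.coe_smul, ← he, ← hact, hQ σ]
    have hceQ : c = connectingClass ((primaryInclusion V p k).restrictField L) (p ^ k) hroot0 hinj (e Q : V.geomPrimaryTorsion p) heQfix := by
      rw [← hfc, hcQ]
      exact map_levelProj_connectingClass V p k π r e he eN heN L Q hQ heQfix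
    -- the fixed point `e (p^k Q) ∈ W*^{D_v}`
    have hmfix : e (p ^ k • Q) ∈ Fx := by
      refine (FixedPoints.mem_addSubgroup (decomp v) _ _).mpr fun d ↦ ?_
      obtain ⟨σ, hσ⟩ := (mem_decomp_iff v (d : absoluteGaloisGroup K)).mp d.2
      rw [Subgroup.smul_def, ← hσ, ← he, ← hact, hQ σ]
    refine ⟨⟨e (p ^ k • Q), hmfix⟩, Subtype.ext ?_⟩
    change connectingClass ((primaryInclusion V p k).restrictField L) (p ^ k) hroot0 hinj (e (root ⟨e (p ^ k • Q), hmfix⟩) : V.geomPrimaryTorsion p) (hfix _) = c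
    rw [hceQ]
    refine connectingClass_eq_of_nsmul_eq hinj _ _ (hfix _) heQfix ?_
    rw [heroot, ← AddSubgroupClass.coe_nsmul, ← map_nsmul]

end LocalFactor

/-! ## §2. (LF.3): `#(𝓞_v ⧸ 2^N) = 2^N` at a split place above `2` of a quadratic field -/

section Residue

variable {K : Type} [Field K] [NumberField K]

/-- **(LF.3) `#(𝓞_v ⧸ 2^N 𝓞_v) = 2^N`** at a place `v` above `2` of a quadratic field `K` with a SECOND place `v̄ ≠ v` above `2` (so `2` splits,
`e(v|2) = f(v|2) = 1`, tree `placesOver_trichotomy_of_finrank_eq_two`): `𝓞_v ≅ ℤ₂` as rings (degree-one completion,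
`Automorphic.exists_ringEquiv_adicCompletion_of_ramificationIdx_eq_one_of_inertiaDeg_eq_one`) and `#(ℤ₂ ⧸ 2^N) = 2^N`
(`Additive.DefectCountFiniteLevel.natCard_quot_adicCompletionIntegers_prime_pow_rat`). This is the factor `#(𝓞_v ⧸ 2^N)` of the master identity p678152.
[cite: NeukirchANT1999, Ch. II §8 Prop. (8.2) and (8.5)] [cite: MilneADT2006, I Lemma 3.3] -/
theorem natCard_quot_adicCompletionIntegers_two_pow_of_split (hK2 : Module.finrank ℚ K = 2) {v vbar : HeightOneSpectrum (𝓞 K)}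
    (hv : ((2 : ℕ) : 𝓞 K) ∈ v.asIdeal) (hvbar : ((2 : ℕ) : 𝓞 K) ∈ vbar.asIdeal) (hne : vbar ≠ v) (N : ℕ) :
    Nat.card (v.adicCompletionIntegers K ⧸ Ideal.span {((2 ^ N : ℕ) : v.adicCompletionIntegers K)}) = 2 ^ N := by
  haveI : Fact (Nat.Prime 2) := ⟨Nat.prime_two⟩
  -- `e(v|2) = f(v|2) = 1`
  have hv' : v.under (𝓞 ℚ) = ratPlace 2 := under_eq_ratPlace_of_mem hv
  have hvbar' : vbar.under (𝓞 ℚ) = ratPlace 2 := under_eq_ratPlace_of_mem hvbar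
  have hef : v.asIdeal.ramificationIdx (𝓞 ℚ) = 1 ∧ v.asIdeal.inertiaDeg (𝓞 ℚ) = 1 := by
    rcases placesOver_trichotomy_of_finrank_eq_two K hK2 (ratPlace 2) with
      ⟨w₁, w₂, -, -, hef⟩ | ⟨w, hset, -, -⟩ | ⟨w, hset, -, -⟩
    · exact hef v hv'
    · have h1 : v ∈ ({w} : Set (HeightOneSpectrum (𝓞 K))) := hset ▸ hv'
      have h2 : vbar ∈ ({w} : Set (HeightOneSpectrum (𝓞 K))) := hset ▸ hvbar'
      exact absurd ((Set.mem_singleton_iff.mp h2).trans (Set.mem_singleton_iff.mp h1).symm) hne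
    · have h1 : v ∈ ({w} : Set (HeightOneSpectrum (𝓞 K))) := hset ▸ hv'
      have h2 : vbar ∈ ({w} : Set (HeightOneSpectrum (𝓞 K))) := hset ▸ hvbar'
      exact absurd ((Set.mem_singleton_iff.mp h2).trans (Set.mem_singleton_iff.mp h1).symm) hne
  -- transport along `ℤ₂ ≅ 𝓞_v`
  haveI : v.asIdeal.LiesOver (ratPlace 2 : HeightOneSpectrum (𝓞 ℚ)).asIdeal := by
    rw [← hv', HeightOneSpectrum.under_asIdeal]; infer_instance
  obtain ⟨ψ, -, -, -⟩ :=
    Literature.NumberTheory.Automorphic.exists_ringEquiv_adicCompletion_of_ramificationIdx_eq_one_of_inertiaDeg_eq_one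
      ℚ K (ratPlace 2) v hef.1 hef.2
  refine (Nat.card_congr (Ideal.quotientEquiv _ _ ψ.symm ?_).toEquiv).trans
    (Rank1Residual.Additive.DefectCountFiniteLevel.natCard_quot_adicCompletionIntegers_prime_pow_rat (primesEquiv_ratPlace 2) N)
  rw [Ideal.map_span, Set.image_singleton, map_natCast]

end Residue

/-! ## §3. (LF.2) on the frame: `#(N^E_v ⊓ range H¹(ẽ_N|K_v)) = #W*(K_v) = 2` -/

section FrameFactor

variable {K : Type} [Field K] [NumberField K]

/-- **(LF.2) ON EVERY S3c FRAME: `#(N^E_v ⊓ range H¹(ẽ_N|K_v)) = 2`** (`N ≥ 1`; `C • W = cm7^{(d)}`, `d ≠ 0` squarefree, `d ≢ 1 (4)`, `K` imaginary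
quadratic, `v ≠ v̄` above `2`, `π² = π − 2`, `r² = r − 2`, pinning clause at `v`; `e` ANY equivariant projector onto `W* = E[𝔮_r^∞]` fixing `W*`, `ẽ_N` ANY
level shadow of it): §1 with `#W*^{D_v} = 2` (-w2 g9 `CMPrimes.natCard_fixedPoints_decomp_v_eq_two_of_frame`), a group of order `2` being killed by `2 ∣ 2^N`.
This is the factor `#(N^E_v ⊓ A)` of the master identity p678152 `relIndex_selmerGroup_update_top_mul_eq_of_levelProj`.
[cite: Agboola2007, §6 and Prop. 8.1] [cite: Rubin1999, §2 and §3 Lemma 3.6 (ii)] [cite: GreenbergLNM1716, §5 proof of Prop. 5.8] -/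
theorem natCard_ker_inf_range_map_levelProj_eq_two_of_frame {d : ℤ} (hd0 : d ≠ 0) (hsq : Squarefree d) (hd4 : d % 4 ≠ 1)
    (W : WeierstrassCurve ℚ) [W.IsElliptic] (C : VariableChange ℚ) (hC : C • W = cm7.quadraticTwist (d : ℚ)) (hK : IsImaginaryQuadratic K)
    (v vbar : HeightOneSpectrum (𝓞 K)) (hv : ((2 : ℕ) : 𝓞 K) ∈ v.asIdeal) (hvbar : ((2 : ℕ) : 𝓞 K) ∈ vbar.asIdeal) (hne : vbar ≠ v)
    (π : (W.baseChange K).endRing) (hrel : (π : AddMonoid.End (W.baseChange K).geomPoints) * π = π - 2) {r : ℤ_[2]} (hr : r * r = r - 2)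
    (hpin : ∀ τ ∈ GreenbergSelmer.inertia v, ∀ x : ↥((W.baseChange K).endEigenPrimaryTorsion 2 π r), τ • x = x ∨ τ • x = -x)
    (e : (W.baseChange K).geomPrimaryTorsion 2 →+ ↥((W.baseChange K).endEigenPrimaryTorsion 2 π r))
    (he₁ : ∀ x : ↥((W.baseChange K).endEigenPrimaryTorsion 2 π r), e x = x)
    (he : ∀ (σ : absoluteGaloisGroup K) (x : (W.baseChange K).geomPrimaryTorsion 2), e (σ • x) = σ • e x)
    {N : ℕ} (hN : 0 < N)
    (eN : ((W.baseChange K).torsionGaloisModule ((2 ^ N : ℕ) : ℤ)).toContRepresentation →ⁱL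
      ((W.baseChange K).torsionGaloisModule ((2 ^ N : ℕ) : ℤ)).toContRepresentation)
    (heN : ∀ y, primaryInclusion (W.baseChange K) 2 N (eN y) = (e (primaryInclusion (W.baseChange K) 2 N y) : (W.baseChange K).geomPrimaryTorsion 2)) :
    Nat.card (((galoisCohomology.map ((primaryInclusion (W.baseChange K) 2 N).restrictField (v.adicCompletion K)) 1).ker ⊓
        (galoisCohomology.map (eN.restrictField (v.adicCompletion K)) 1).range : AddSubgroup _)) = 2 := by
  haveI : Fact (Nat.Prime 2) := ⟨Nat.prime_two⟩
  haveI : (W.baseChange K).IsElliptic := by rw [baseChange]; infer_instance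
  have h2 := CMPrimes.natCard_fixedPoints_decomp_v_eq_two_of_frame hd0 hsq hd4 W C hC hK v vbar hv hvbar hne π hrel hr hpin
  refine Eq.trans (natCard_ker_inf_range_map_levelProj_eq (W.baseChange K) 2 N π r e he₁ he eN heN v fun m hm ↦ ?_) h2
  -- `m ∈ W*^{D_v}`, a group of order `2`: `2 • m = 0`, hence `2^N • m = 0`
  have hmF : m ∈ FixedPoints.addSubgroup (decomp v) ↥((W.baseChange K).endEigenPrimaryTorsion 2 π r) :=
    (FixedPoints.mem_addSubgroup (decomp v) _ _).mpr fun d ↦ hm d d.2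
  have h2m : Nat.card (FixedPoints.addSubgroup (decomp v) ↥((W.baseChange K).endEigenPrimaryTorsion 2 π r)) •
      (⟨m, hmF⟩ : FixedPoints.addSubgroup (decomp v) ↥((W.baseChange K).endEigenPrimaryTorsion 2 π r)) = 0 :=
    addOrderOf_dvd_iff_nsmul_eq_zero.mp (addOrderOf_dvd_natCard _)
  rw [h2] at h2m
  have h2m' : (2 : ℕ) • m = 0 := by
    have := congrArg Subtype.val h2m
    simpa using this
  obtain ⟨n, rfl⟩ := Nat.exists_eq_succ_of_ne_zero hN.ne'
  rw [pow_succ, mul_smul, h2m', smul_zero]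

end FrameFactor

end Summit.BirchSwinnertonDyer.BirchSwinnertonDyer.Theorems.PrintCf2.RestrictedSelmerPair

end
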